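import Literature.AlgebraicGeometry.Deformation.SmoothAffineDeformationsPrincipalRestriction
import Literature.AlgebraicGeometry.Deformation.FlatDeformationChartTrivialisations
import Literature.AlgebraicGeometry.Deformation.SmoothSchemeLiftObstructionCechCocycle
import HarnessLib

/-!
# The transition data of a flat deformation on a principal affine cover are admissible and cocycle-exact
# (Hartshorne, *Deformation Theory*, proof of Thm. 10.2 (a): «`U'_i ≅ U_i ×_k Spec A'` … on `U_{ij}` … on `U_{ijk}`»)

Layer `Literature/AlgebraicGeometry/Deformation` (THEOREMS only); file (c2b) «overlaps» of the F3c DICTIONARY «an actual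
flat deformation ↦ cocycle-exact gluing data» (cell `hodgecm-mathlib`, F-11 (A3); consumer: (c2c) `Glue_A(ψ) ≅ Y`).
Setting: `k` a field, `A` an Artinian local `k`-algebra with augmentation `π : A → k` (`𝔫 = ker π` nilpotent); the closed
fibre `X → Spec k` (★ K1 convention `[∀ W, Algebra k Γ(X, W)]` + `halg`) SMOOTH; `Y → Spec A` FLAT with the twin
convention `[∀ W, Algebra A Γ(Y, W)]` + `halgA`; `i : X → Y` the closed fibre (`IsPullback i X.hom Y.hom (Spec π)`); a
principal affine cover UPSTAIRS `U' j`, `U' j ∩ U' l = D(b' j l)`; downstairs `i⁻¹U' j` (affine), `i⁻¹U'j ∩ i⁻¹U'l = D(i♯ b'jl)`.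
* §2 `exists_restrict_algEquiv` — restriction of a trivialisation `A ⊗_k Γ(X, i⁻¹W) ≃ₐ[A] Γ(Y, W)` to a principal open
  `D(g') ⊆ W` (c1 `exists_restrict_trivialization`; scheme-side inputs: Mathlib `IsAffineOpen.isLocalization_of_eq_basicOpen`,
  c2a `ker_app`), and `restrict_restrict` (c1 `restrict_compat`); §3 `exists_chart_algEquiv` — c2a's chart trivialisation as
  an `A`-ALGEBRA isomorphism over the closed fibres;
* §4 **`exists_transition_data`** — chart trivialisations `e j`, their overlap restrictions `ε₁ j l` (of `e j`), `ε₂ j l`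
  (of `e l`), with `ψ j l := SmoothAffineDeformation.transition (ε₁ j l) (ε₂ j l)` ADMISSIBLE (`ψ x - x ∈ 𝔫 · (A ⊗ Γ)`,
  ★ `transition_apply_sub_mem`) and COCYCLE-EXACT in the `∀`-form of the glue datum `deformationGlueDatum`
  (c1 `cocycle_clause_of_restrict` on the triple-overlap restrictions).
HC_CM is proved only modulo the 7 printed citations until rung 0 closes — nothing here bears on a summit statement.

## References
* [Hartshorne2010] R. Hartshorne, *Deformation Theory*, GTM 257, Springer (2010): Thm. 10.2 (a) and its proof (p. 81);
  Cor. 4.8 (pp. 32–33); Thm. 5.3 (proof) (p. 42).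
* [GortzWedhorn2020] U. Görtz, T. Wedhorn, *Algebraic Geometry I*, 2nd ed. (2020): Prop. 4.20; Thm. 2.33 / (2.11)
  (`Γ(D(f)) = Γ(X)_f`).
* [AtiyahMacdonald1969] M. F. Atiyah, I. G. Macdonald, *Introduction to Commutative Algebra* (1969): Prop. 3.5.
-/

noncomputable section

-- `TopCat.Presheaf`/`TopCat.Sheaf` are not reducible (as in Mathlib's `AlgebraicGeometry/Modules`).
set_option backward.isDefEq.respectTransparency false

open CategoryTheory AlgebraicGeometry Opposite TopologicalSpace Limits
open scoped TensorProduct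

universe u

namespace Literature.AlgebraicGeometry.Deformation

open Literature.AlgebraicGeometry.Motives Literature.AlgebraicGeometry.Morphisms SmoothAffineDeformation

variable {k : Type u} [Field k] {A : Type u} [CommRing A] [Algebra k A] (π : A →ₐ[k] k)
  {X : Over (Spec (CommRingCat.of k))} [instΓ : ∀ W : X.left.Opens, Algebra k Γ(X.left, W)]
  (halg : ∀ (W : X.left.Opens) (s : k), algebraMap k Γ(X.left, W) s = (constToPresheaf X).app (op W) s)
  {Y : Over (Spec (CommRingCat.of A))} [instΓA : ∀ W : Y.left.Opens, Algebra A Γ(Y.left, W)]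
  (halgA : ∀ (W : Y.left.Opens) (a : A), algebraMap A Γ(Y.left, W) a = (constToPresheaf Y).app (op W) a)
  (i : X.left ⟶ Y.left) (hi : IsPullback i X.hom Y.hom (Spec.map (CommRingCat.ofHom π.toRingHom)))

/-! ## §0 The two structure conventions and the closed-fibre maps -/

include halgA in
/-- The `A`-structure of `Γ(Y, W)` is `a ↦ a|_W` (`constToPresheaf` unfolded). [cite: Hartshorne2010, Thm. 10.2 (proof), p. 81] -/
theorem algebraMap_eq_appLE (W : Y.left.Opens) (a : A) :
    algebraMap A Γ(Y.left, W) a = Y.hom.appLE ⊤ W le_top ((Scheme.ΓSpecIso (CommRingCat.of A)).inv a) := by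
  rw [halgA]; rfl

include halgA in
/-- Restriction `Γ(Y, W) → Γ(Y, W₁)` commutes with the `A`-structures. [cite: Hartshorne2010, Thm. 10.2 (proof), p. 81] -/
theorem map_algebraMap_A {W W₁ : Y.left.Opens} (h : W₁ ≤ W) (a : A) :
    Y.left.presheaf.map (homOfLE h).op (algebraMap A Γ(Y.left, W) a) = algebraMap A Γ(Y.left, W₁) a := by
  rw [halgA, halgA]
  change (Y.left.presheaf.map (homOfLE (le_top : W ≤ ⊤)).op ≫ Y.left.presheaf.map (homOfLE h).op) _ =
    Y.left.presheaf.map (homOfLE (le_top : W₁ ≤ ⊤)).op _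
  rw [← Y.left.presheaf.map_comp]
  rfl

include halg in
/-- Restriction commutes with the `k`-structures (the variable instance fixed by `halg`; for the canonical one this
is ★ `Motives.FieldNorm.map_algebraMap_sec`, whence `private`). [cite: Hartshorne1977, II.8 p. 172] -/
private theorem map_algebraMap_k {V V₁ : X.left.Opens} (h : V₁ ≤ V) (s : k) :
    X.left.presheaf.map (homOfLE h).op (algebraMap k Γ(X.left, V) s) = algebraMap k Γ(X.left, V₁) s := by
  rw [halg, halg, map_constToPresheaf_app_of_le]

include hi halg halgA in
/-- The closed-fibre map `i♯ : Γ(Y, W) → Γ(X, V)` (`V ⊆ i⁻¹W`) commutes with the `k`-structures: `i♯(c · 1) = c · 1`.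
[cite: Hartshorne2010, Thm. 10.2 (proof), p. 81] -/
theorem appLE_algebraMap {W : Y.left.Opens} {V : X.left.Opens} (hV : V ≤ i ⁻¹ᵁ W) (c : k) :
    i.appLE W V hV (algebraMap A Γ(Y.left, W) (algebraMap k A c)) = algebraMap k Γ(X.left, V) c := by
  rw [algebraMap_eq_appLE halgA, Scheme.Hom.appLE, CommRingCat.comp_apply, app_structureMap π halg i hi,
    AlgHom.commutes, Algebra.algebraMap_self, RingHom.id_apply, map_algebraMap_k halg]

/-! ## §1 The derived principal affine cover downstairs -/

omit instΓ instΓA in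
include hi in
/-- `i⁻¹W` is affine for `W ⊆ Y` affine (the closed fibre is an affine morphism). [cite: GortzWedhorn2020, Prop. 4.20] -/
theorem isAffineOpen_preimage_closedFibre {W : Y.left.Opens} (hW : IsAffineOpen W) : IsAffineOpen (i ⁻¹ᵁ W) :=
  letI : Algebra A k := π.toRingHom.toAlgebra
  isAffineOpen_preimage_of_isPullback Y.hom i X.hom hi hW

omit [Algebra k A] instΓ instΓA in
/-- `i⁻¹W ∩ i⁻¹W' = D(i♯ g')` when `W ∩ W' = D(g')`: the principal affine cover upstairs induces one downstairs.
[cite: Hartshorne2010, Thm. 10.2 (proof), p. 81] -/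
theorem inf_preimage_eq_basicOpen {W W' : Y.left.Opens} (g' : Γ(Y.left, W)) (h : W ⊓ W' = Y.left.basicOpen g') :
    i ⁻¹ᵁ W ⊓ i ⁻¹ᵁ W' = X.left.basicOpen (i.app W g') := by
  rw [← Scheme.preimage_basicOpen, ← h]
  rfl

/-! ## §2 Restricting a trivialisation to a principal open, on the scheme -/

include hi halg halgA in
/-- **Restriction of a chart trivialisation to a principal open** (c1 `exists_restrict_trivialization` on the scheme):
for `W ⊆ Y` affine, `W₁ = D(g') ⊆ W`, `V₁ = i⁻¹W₁` and a trivialisation `e : A ⊗_k Γ(X, i⁻¹W) ≃ₐ[A] Γ(Y, W)` over the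
closed fibres, some trivialisation `ε : A ⊗_k Γ(X, V₁) ≃ₐ[A] Γ(Y, W₁)` over the closed fibres restricts `e`
(`ε (a ⊗ s|) = e(a ⊗ s)|`; inputs `Γ(Y, W₁) = Γ(Y, W)_{g'}`, `Γ(X, V₁) = Γ(X, i⁻¹W)_{i♯g'}`, `ker i♯_W = 𝔫Γ(Y, W)`).
[cite: Hartshorne2010, Thm. 10.2 (proof), p. 81: «restricting to `U_{ij}`»] [cite: AtiyahMacdonald1969, Prop. 3.5] -/
theorem exists_restrict_algEquiv (h𝔫 : IsNilpotent (RingHom.ker π)) {W W₁ : Y.left.Opens} (hW : IsAffineOpen W)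
    (g' : Γ(Y.left, W)) (hW₁ : W₁ = Y.left.basicOpen g') (hW₁W : W₁ ≤ W)
    {V₁ : X.left.Opens} (hV₁ : V₁ = i ⁻¹ᵁ W₁) (hV₁V : V₁ ≤ i ⁻¹ᵁ W)
    (e : A ⊗[k] Γ(X.left, i ⁻¹ᵁ W) ≃ₐ[A] Γ(Y.left, W)) (he : ∀ x, i.app W (e x) = specialFibreHom π _ x) :
    ∃ ε : A ⊗[k] Γ(X.left, V₁) ≃ₐ[A] Γ(Y.left, W₁),
      (∀ (a : A) (s : Γ(X.left, i ⁻¹ᵁ W)), ε (a ⊗ₜ X.left.presheaf.map (homOfLE hV₁V).op s) =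
        Y.left.presheaf.map (homOfLE hW₁W).op (e (a ⊗ₜ s))) ∧
      (∀ y, i.appLE W₁ V₁ hV₁.le (ε y) = specialFibreHom π _ y) := by
  -- the `k`-structures upstairs and the restriction algebras
  letI algkW : Algebra k Γ(Y.left, W) := ((algebraMap A Γ(Y.left, W)).comp (algebraMap k A)).toAlgebra
  letI algkW₁ : Algebra k Γ(Y.left, W₁) := ((algebraMap A Γ(Y.left, W₁)).comp (algebraMap k A)).toAlgebra
  letI algX : Algebra Γ(X.left, i ⁻¹ᵁ W) Γ(X.left, V₁) := (X.left.presheaf.map (homOfLE hV₁V).op).hom.toAlgebra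
  haveI : IsScalarTower k Γ(X.left, i ⁻¹ᵁ W) Γ(X.left, V₁) :=
    IsScalarTower.of_algebraMap_eq fun c => (map_algebraMap_k halg hV₁V c).symm
  letI algY : Algebra Γ(Y.left, W) Γ(Y.left, W₁) := (Y.left.presheaf.map (homOfLE hW₁W).op).hom.toAlgebra
  haveI : IsScalarTower A Γ(Y.left, W) Γ(Y.left, W₁) :=
    IsScalarTower.of_algebraMap_eq fun a => (map_algebraMap_A halgA hW₁W a).symm
  -- the two localisations
  haveI : IsLocalization.Away g' Γ(Y.left, W₁) := hW.isLocalization_of_eq_basicOpen g' (homOfLE hW₁W) hW₁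
  haveI : IsLocalization.Away (i.app W g') Γ(X.left, V₁) :=
    (isAffineOpen_preimage_closedFibre π i hi hW).isLocalization_of_eq_basicOpen (i.app W g') (homOfLE hV₁V)
      (by rw [hV₁, hW₁, Scheme.preimage_basicOpen])
  -- the closed-fibre maps as `k`-algebra maps
  let ρ : Γ(Y.left, W) →ₐ[k] Γ(X.left, i ⁻¹ᵁ W) :=
    { (i.app W).hom with
      commutes' := fun c => by
        change i.app W (algebraMap A Γ(Y.left, W) (algebraMap k A c)) = _
        rw [Scheme.Hom.app_eq_appLE]
        exact appLE_algebraMap π halg halgA i hi le_rfl c }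
  let ρ' : Γ(Y.left, W₁) →ₐ[k] Γ(X.left, V₁) :=
    { (i.appLE W₁ V₁ hV₁.le).hom with
      commutes' := fun c => appLE_algebraMap π halg halgA i hi hV₁.le c }
  have hker : RingHom.ker ρ = (RingHom.ker π).map (algebraMap A Γ(Y.left, W)) := by
    have h := ker_app π i hi hW
    have hφ : algebraMap A Γ(Y.left, W) =
        (Y.hom.appLE ⊤ W le_top).hom.comp (Scheme.ΓSpecIso (CommRingCat.of A)).inv.hom :=
      RingHom.ext fun a => algebraMap_eq_appLE halgA W a
    rw [hφ, ← h]
    rfl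
  have hρ' : ∀ b, ρ' (algebraMap Γ(Y.left, W) Γ(Y.left, W₁) b) =
      algebraMap Γ(X.left, i ⁻¹ᵁ W) Γ(X.left, V₁) (ρ b) := fun b => by
    change (Y.left.presheaf.map (homOfLE hW₁W).op ≫ i.appLE W₁ V₁ hV₁.le) b =
      (i.app W ≫ X.left.presheaf.map (homOfLE hV₁V).op) b
    rw [Scheme.Hom.map_appLE]
    rfl
  obtain ⟨ε, h₁, h₂⟩ := exists_restrict_trivialization π h𝔫 ρ hker g' (i.app W g') rfl ρ' hρ' e he
  exact ⟨ε, h₁, h₂⟩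

include hi halg halgA in
/-- **Restrictions compose** (c1 `restrict_compat` on the scheme): if `ε` over `W₁ = D(g') ⊆ W` and `δ` over `W₂ ⊆ W₁`
both restrict the chart trivialisation `e` over `W`, then `δ` restricts `ε`. [cite: Hartshorne2010, Thm. 10.2 (proof), p. 81] -/
theorem restrict_restrict {W W₁ W₂ : Y.left.Opens} (hW : IsAffineOpen W) (g' : Γ(Y.left, W))
    (hW₁ : W₁ = Y.left.basicOpen g') (hW₁W : W₁ ≤ W) (hW₂W₁ : W₂ ≤ W₁)
    {V₁ V₂ : X.left.Opens} (hV₁ : V₁ = i ⁻¹ᵁ W₁) (hV₁V : V₁ ≤ i ⁻¹ᵁ W) (hV₂V₁ : V₂ ≤ V₁)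
    (e : A ⊗[k] Γ(X.left, i ⁻¹ᵁ W) ≃ₐ[A] Γ(Y.left, W)) (ε : A ⊗[k] Γ(X.left, V₁) ≃ₐ[A] Γ(Y.left, W₁))
    (hε : ∀ (a : A) (s : Γ(X.left, i ⁻¹ᵁ W)), ε (a ⊗ₜ X.left.presheaf.map (homOfLE hV₁V).op s) =
      Y.left.presheaf.map (homOfLE hW₁W).op (e (a ⊗ₜ s)))
    (δ : A ⊗[k] Γ(X.left, V₂) ≃ₐ[A] Γ(Y.left, W₂))
    (hδ : ∀ (a : A) (s : Γ(X.left, i ⁻¹ᵁ W)), δ (a ⊗ₜ X.left.presheaf.map (homOfLE (hV₂V₁.trans hV₁V)).op s) =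
      Y.left.presheaf.map (homOfLE (hW₂W₁.trans hW₁W)).op (e (a ⊗ₜ s)))
    (a : A) (c : Γ(X.left, V₁)) :
    δ (a ⊗ₜ X.left.presheaf.map (homOfLE hV₂V₁).op c) = Y.left.presheaf.map (homOfLE hW₂W₁).op (ε (a ⊗ₜ c)) := by
  letI : Algebra Γ(X.left, i ⁻¹ᵁ W) Γ(X.left, V₁) := (X.left.presheaf.map (homOfLE hV₁V).op).hom.toAlgebra
  haveI : IsScalarTower k Γ(X.left, i ⁻¹ᵁ W) Γ(X.left, V₁) :=
    IsScalarTower.of_algebraMap_eq fun c => (map_algebraMap_k halg hV₁V c).symm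
  letI : Algebra Γ(X.left, i ⁻¹ᵁ W) Γ(X.left, V₂) :=
    (X.left.presheaf.map (homOfLE (hV₂V₁.trans hV₁V)).op).hom.toAlgebra
  haveI : IsScalarTower k Γ(X.left, i ⁻¹ᵁ W) Γ(X.left, V₂) :=
    IsScalarTower.of_algebraMap_eq fun c => (map_algebraMap_k halg (hV₂V₁.trans hV₁V) c).symm
  letI : Algebra Γ(X.left, V₁) Γ(X.left, V₂) := (X.left.presheaf.map (homOfLE hV₂V₁).op).hom.toAlgebra
  haveI : IsScalarTower Γ(X.left, i ⁻¹ᵁ W) Γ(X.left, V₁) Γ(X.left, V₂) :=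
    IsScalarTower.of_algebraMap_eq fun s => by
      change X.left.presheaf.map (homOfLE (hV₂V₁.trans hV₁V)).op s =
        (X.left.presheaf.map (homOfLE hV₁V).op ≫ X.left.presheaf.map (homOfLE hV₂V₁).op) s
      rw [← X.left.presheaf.map_comp]
      rfl
  haveI : IsScalarTower k Γ(X.left, V₁) Γ(X.left, V₂) :=
    IsScalarTower.of_algebraMap_eq fun c => (map_algebraMap_k halg hV₂V₁ c).symm
  letI : Algebra Γ(Y.left, W) Γ(Y.left, W₁) := (Y.left.presheaf.map (homOfLE hW₁W).op).hom.toAlgebra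
  haveI : IsScalarTower A Γ(Y.left, W) Γ(Y.left, W₁) :=
    IsScalarTower.of_algebraMap_eq fun a => (map_algebraMap_A halgA hW₁W a).symm
  letI : Algebra Γ(Y.left, W) Γ(Y.left, W₂) := (Y.left.presheaf.map (homOfLE (hW₂W₁.trans hW₁W)).op).hom.toAlgebra
  haveI : IsScalarTower A Γ(Y.left, W) Γ(Y.left, W₂) :=
    IsScalarTower.of_algebraMap_eq fun a => (map_algebraMap_A halgA (hW₂W₁.trans hW₁W) a).symm
  letI : Algebra Γ(Y.left, W₁) Γ(Y.left, W₂) := (Y.left.presheaf.map (homOfLE hW₂W₁).op).hom.toAlgebra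
  haveI : IsScalarTower Γ(Y.left, W) Γ(Y.left, W₁) Γ(Y.left, W₂) :=
    IsScalarTower.of_algebraMap_eq fun s => by
      change Y.left.presheaf.map (homOfLE (hW₂W₁.trans hW₁W)).op s =
        (Y.left.presheaf.map (homOfLE hW₁W).op ≫ Y.left.presheaf.map (homOfLE hW₂W₁).op) s
      rw [← Y.left.presheaf.map_comp]
      rfl
  haveI : IsScalarTower A Γ(Y.left, W₁) Γ(Y.left, W₂) :=
    IsScalarTower.of_algebraMap_eq fun a => (map_algebraMap_A halgA hW₂W₁ a).symm
  haveI : IsLocalization.Away (i.app W g') Γ(X.left, V₁) :=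
    (isAffineOpen_preimage_closedFibre π i hi hW).isLocalization_of_eq_basicOpen (i.app W g') (homOfLE hV₁V)
      (by rw [hV₁, hW₁, Scheme.preimage_basicOpen])
  exact restrict_compat (k := k) (i.app W g') e ε hε δ hδ a c

/-! ## §3 The chart trivialisations as `A`-algebra isomorphisms -/

include hi halg halgA in
/-- **The affine charts of a flat deformation are trivial, as `A`-algebras** (c2a `exists_chart_trivialisation`: its ring
isomorphism extends the `A`-structure), over the closed fibres. [cite: Hartshorne2010, Cor. 4.8, pp. 32–33; Thm. 10.2 (proof), p. 81] -/
theorem exists_chart_algEquiv [IsArtinianRing A] [IsLocalRing A] [Smooth X.hom] [Flat Y.hom]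
    {W : Y.left.Opens} (hW : IsAffineOpen W) :
    ∃ e : A ⊗[k] Γ(X.left, i ⁻¹ᵁ W) ≃ₐ[A] Γ(Y.left, W), ∀ x, i.app W (e x) = specialFibreHom π _ x := by
  obtain ⟨e, he₁, he₂⟩ := exists_chart_trivialisation π halg i hi hW
  have hcomm : ∀ a, e (algebraMap A (A ⊗[k] Γ(X.left, i ⁻¹ᵁ W)) a) = algebraMap A Γ(Y.left, W) a := fun a => by
    rw [Algebra.TensorProduct.algebraMap_apply, Algebra.algebraMap_self, RingHom.id_apply, he₁,
      algebraMap_eq_appLE halgA]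
  refine ⟨AlgEquiv.ofRingEquiv (f := e) hcomm, fun x => ?_⟩
  change i.app W (e x) = _
  induction x using TensorProduct.induction_on with
  | zero => simp
  | tmul a s => rw [he₂, specialFibreHom_tmul]
  | add x y hx hy => rw [map_add, map_add, hx, hy, map_add]

/-! ## §4 The transition data of a principal affine cover: admissible and cocycle-exact -/

include hi halg halgA in
/-- **THE TRANSITION DATA OF A FLAT DEFORMATION** (proof of Thm. 10.2 (a) read backwards: an actual deformation `Y`
of `X` over `A` gives «`φ_i : U_i ×_k Spec A ≅ U'_i`», «on `U_{ij}`» the automorphisms `ψ_{ij} = φ_j⁻¹ φ_i`, compatible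
«on `U_{ijk}`»): for a principal affine cover `U'` of `Y` there are chart trivialisations `e j` over the closed fibres
and their overlap restrictions `ε₁ j l` (of `e j`), `ε₂ j l` (of `e l`), such that the `ψ j l := transition (ε₁ j l) (ε₂ j l)`
are ADMISSIBLE (`ψ x - x ∈ 𝔫 · (A ⊗ Γ)`, `𝔫 = ker π`) and COCYCLE-EXACT in the `∀`-form of the glue datum
(`ρ_{lm} ρ_{jl} = ρ_{jm}` for any restrictions `ρ` of the `ψ` to the triple overlaps along any base-change maps `Φ`).
[cite: Hartshorne2010, Thm. 10.2 (proof), p. 81] [cite: Hartshorne2010, Thm. 5.3 (proof), p. 42] -/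
theorem exists_transition_data [IsArtinianRing A] [IsLocalRing A] [Smooth X.hom] [Flat Y.hom]
    {ι : Type u} (U' : ι → Y.left.affineOpens) (b' : (j l : ι) → Γ(Y.left, (U' j).1))
    (hb' : ∀ j l, (U' j).1 ⊓ (U' l).1 = Y.left.basicOpen (b' j l)) :
    ∃ (e : ∀ j, A ⊗[k] Γ(X.left, i ⁻¹ᵁ (U' j).1) ≃ₐ[A] Γ(Y.left, (U' j).1))
      (ε₁ ε₂ : ∀ j l, A ⊗[k] Γ(X.left, i ⁻¹ᵁ (U' j).1 ⊓ i ⁻¹ᵁ (U' l).1) ≃ₐ[A] Γ(Y.left, (U' j).1 ⊓ (U' l).1)),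
      (∀ j x, i.app (U' j).1 (e j x) = specialFibreHom π _ x) ∧
      (∀ j l (a : A) (s : Γ(X.left, i ⁻¹ᵁ (U' j).1)),
        ε₁ j l (a ⊗ₜ X.left.presheaf.map (homOfLE inf_le_left).op s) =
          Y.left.presheaf.map (homOfLE inf_le_left).op (e j (a ⊗ₜ s))) ∧
      (∀ j l (a : A) (s : Γ(X.left, i ⁻¹ᵁ (U' l).1)),
        ε₂ j l (a ⊗ₜ X.left.presheaf.map (homOfLE inf_le_right).op s) =
          Y.left.presheaf.map (homOfLE inf_le_right).op (e l (a ⊗ₜ s))) ∧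
      (∀ j l y, i.appLE ((U' j).1 ⊓ (U' l).1) (i ⁻¹ᵁ (U' j).1 ⊓ i ⁻¹ᵁ (U' l).1) (i.preimage_inf).ge (ε₁ j l y) =
        specialFibreHom π _ y) ∧
      (∀ j l y, i.appLE ((U' j).1 ⊓ (U' l).1) (i ⁻¹ᵁ (U' j).1 ⊓ i ⁻¹ᵁ (U' l).1) (i.preimage_inf).ge (ε₂ j l y) =
        specialFibreHom π _ y) ∧
      (∀ j l x, transition (ε₁ j l) (ε₂ j l) x - x ∈
        (RingHom.ker π) • (⊤ : Submodule A (A ⊗[k] Γ(X.left, i ⁻¹ᵁ (U' j).1 ⊓ i ⁻¹ᵁ (U' l).1)))) ∧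
      (∀ (j l m : ι)
        (Φjl : A ⊗[k] Γ(X.left, i ⁻¹ᵁ (U' j).1 ⊓ i ⁻¹ᵁ (U' l).1) →ₐ[A]
          A ⊗[k] Γ(X.left, i ⁻¹ᵁ (U' j).1 ⊓ i ⁻¹ᵁ (U' l).1 ⊓ i ⁻¹ᵁ (U' m).1))
        (_ : ∀ a s, Φjl (a ⊗ₜ s) = a ⊗ₜ X.left.presheaf.map (homOfLE inf_le_left).op s)
        (Φlm : A ⊗[k] Γ(X.left, i ⁻¹ᵁ (U' l).1 ⊓ i ⁻¹ᵁ (U' m).1) →ₐ[A]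
          A ⊗[k] Γ(X.left, i ⁻¹ᵁ (U' j).1 ⊓ i ⁻¹ᵁ (U' l).1 ⊓ i ⁻¹ᵁ (U' m).1))
        (_ : ∀ a s, Φlm (a ⊗ₜ s) = a ⊗ₜ X.left.presheaf.map
          (homOfLE (le_inf (inf_le_left.trans inf_le_right) inf_le_right)).op s)
        (Φjm : A ⊗[k] Γ(X.left, i ⁻¹ᵁ (U' j).1 ⊓ i ⁻¹ᵁ (U' m).1) →ₐ[A]
          A ⊗[k] Γ(X.left, i ⁻¹ᵁ (U' j).1 ⊓ i ⁻¹ᵁ (U' l).1 ⊓ i ⁻¹ᵁ (U' m).1))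
        (_ : ∀ a s, Φjm (a ⊗ₜ s) = a ⊗ₜ X.left.presheaf.map
          (homOfLE (le_inf (inf_le_left.trans inf_le_left) inf_le_right)).op s)
        (ρjl ρlm ρjm : A ⊗[k] Γ(X.left, i ⁻¹ᵁ (U' j).1 ⊓ i ⁻¹ᵁ (U' l).1 ⊓ i ⁻¹ᵁ (U' m).1) ≃ₐ[A]
          A ⊗[k] Γ(X.left, i ⁻¹ᵁ (U' j).1 ⊓ i ⁻¹ᵁ (U' l).1 ⊓ i ⁻¹ᵁ (U' m).1)),
        (∀ x, ρjl (Φjl x) = Φjl (transition (ε₁ j l) (ε₂ j l) x)) →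
        (∀ x, ρlm (Φlm x) = Φlm (transition (ε₁ l m) (ε₂ l m) x)) →
        (∀ x, ρjm (Φjm x) = Φjm (transition (ε₁ j m) (ε₂ j m) x)) → ρlm * ρjl = ρjm) := by
  have h𝔫 : IsNilpotent (RingHom.ker π) := isNilpotent_ker_of_isArtinianRing π
  have hVaff : ∀ j, IsAffineOpen (i ⁻¹ᵁ (U' j).1) := fun j => isAffineOpen_preimage_closedFibre π i hi (U' j).2
  have hpre : ∀ j l, i ⁻¹ᵁ (U' j).1 ⊓ i ⁻¹ᵁ (U' l).1 = i ⁻¹ᵁ ((U' j).1 ⊓ (U' l).1) := fun j l =>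
    (i.preimage_inf).symm
  have hb'' : ∀ j l, (U' j).1 ⊓ (U' l).1 = Y.left.basicOpen (b' l j) := fun j l =>
    (inf_comm _ _).trans (hb' l j)
  choose e he using fun j => exists_chart_algEquiv π halg halgA i hi (U' j).2
  choose ε₁ hε₁ hε₁' using fun j l => exists_restrict_algEquiv π halg halgA i hi h𝔫 (U' j).2 (b' j l) (hb' j l)
    inf_le_left (hpre j l) inf_le_left (e j) (he j)
  choose ε₂ hε₂ hε₂' using fun j l => exists_restrict_algEquiv π halg halgA i hi h𝔫 (U' l).2 (b' l j) (hb'' j l)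
    inf_le_right (hpre j l) inf_le_right (e l) (he l)
  refine ⟨e, ε₁, ε₂, he, hε₁, hε₂, hε₁', hε₂', fun j l x => ?_, ?_⟩
  · -- admissibility: `ψ ≡ 1 (mod 𝔫)` (★ `transition_apply_sub_mem`)
    letI : Algebra k Γ(Y.left, (U' j).1 ⊓ (U' l).1) :=
      ((algebraMap A Γ(Y.left, (U' j).1 ⊓ (U' l).1)).comp (algebraMap k A)).toAlgebra
    let ρ' : Γ(Y.left, (U' j).1 ⊓ (U' l).1) →ₐ[k] Γ(X.left, i ⁻¹ᵁ (U' j).1 ⊓ i ⁻¹ᵁ (U' l).1) :=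
      { (i.appLE ((U' j).1 ⊓ (U' l).1) (i ⁻¹ᵁ (U' j).1 ⊓ i ⁻¹ᵁ (U' l).1) (i.preimage_inf).ge).hom with
        commutes' := fun c => appLE_algebraMap π halg halgA i hi _ c }
    exact transition_apply_sub_mem π ρ' (ε₁ j l) (ε₂ j l) (hε₁' j l) (hε₂' j l) x
  · -- the cocycle clause on the triple overlaps (c1 `cocycle_clause_of_restrict`)
    intro j l m Φjl hΦjl Φlm hΦlm Φjm hΦjm ρjl ρlm ρjm h1 h2 h3
    -- the triple overlaps `W₃ = U'_j ∩ U'_l ∩ U'_m`, `V₃ = i⁻¹W₃`, principal in each chart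
    have hV₃ : i ⁻¹ᵁ (U' j).1 ⊓ i ⁻¹ᵁ (U' l).1 ⊓ i ⁻¹ᵁ (U' m).1 = i ⁻¹ᵁ ((U' j).1 ⊓ (U' l).1 ⊓ (U' m).1) := by
      rw [Scheme.Hom.preimage_inf, Scheme.Hom.preimage_inf]
    have hWj : (U' j).1 ⊓ (U' l).1 ⊓ (U' m).1 = Y.left.basicOpen (b' j l * b' j m) := by
      rw [Scheme.basicOpen_mul, ← hb' j l, ← hb' j m, inf_assoc, inf_inf_distrib_left]
    have hWl : (U' j).1 ⊓ (U' l).1 ⊓ (U' m).1 = Y.left.basicOpen (b' l j * b' l m) := by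
      rw [Scheme.basicOpen_mul, ← hb' l j, ← hb' l m, ← inf_inf_distrib_left, ← inf_assoc, inf_comm (U' l).1]
    have hWm : (U' j).1 ⊓ (U' l).1 ⊓ (U' m).1 = Y.left.basicOpen (b' m j * b' m l) := by
      rw [Scheme.basicOpen_mul, ← hb' m j, ← hb' m l, ← inf_inf_distrib_left, inf_comm (U' m).1]
    -- the triple-overlap restrictions `δ` of the three chart trivialisations
    obtain ⟨δj, hδj, -⟩ := exists_restrict_algEquiv π halg halgA i hi h𝔫 (U' j).2 (b' j l * b' j m) hWj
      (inf_le_left.trans inf_le_left) hV₃ (inf_le_left.trans inf_le_left) (e j) (he j)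
    obtain ⟨δl, hδl, -⟩ := exists_restrict_algEquiv π halg halgA i hi h𝔫 (U' l).2 (b' l j * b' l m) hWl
      (inf_le_left.trans inf_le_right) hV₃ (inf_le_left.trans inf_le_right) (e l) (he l)
    obtain ⟨δm, hδm, -⟩ := exists_restrict_algEquiv π halg halgA i hi h𝔫 (U' m).2 (b' m j * b' m l) hWm
      inf_le_right hV₃ inf_le_right (e m) (he m)
    -- the six compatibilities «`δ` restricts `ε`»
    have hW₂ : (U' j).1 ⊓ (U' l).1 ⊓ (U' m).1 ≤ (U' l).1 ⊓ (U' m).1 :=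
      le_inf (inf_le_left.trans inf_le_right) inf_le_right
    have hV₂ : i ⁻¹ᵁ (U' j).1 ⊓ i ⁻¹ᵁ (U' l).1 ⊓ i ⁻¹ᵁ (U' m).1 ≤ i ⁻¹ᵁ (U' l).1 ⊓ i ⁻¹ᵁ (U' m).1 :=
      le_inf (inf_le_left.trans inf_le_right) inf_le_right
    have hW₃ : (U' j).1 ⊓ (U' l).1 ⊓ (U' m).1 ≤ (U' j).1 ⊓ (U' m).1 :=
      le_inf (inf_le_left.trans inf_le_left) inf_le_right
    have hV₃' : i ⁻¹ᵁ (U' j).1 ⊓ i ⁻¹ᵁ (U' l).1 ⊓ i ⁻¹ᵁ (U' m).1 ≤ i ⁻¹ᵁ (U' j).1 ⊓ i ⁻¹ᵁ (U' m).1 :=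
      le_inf (inf_le_left.trans inf_le_left) inf_le_right
    have cj1 := restrict_restrict π halg halgA i hi (U' j).2 (b' j l) (hb' j l) inf_le_left inf_le_left (hpre j l)
      inf_le_left inf_le_left (e j) (ε₁ j l) (hε₁ j l) δj hδj
    have cl1 := restrict_restrict π halg halgA i hi (U' l).2 (b' l j) (hb'' j l) inf_le_right inf_le_left (hpre j l)
      inf_le_right inf_le_left (e l) (ε₂ j l) (hε₂ j l) δl hδl
    have cl2 := restrict_restrict π halg halgA i hi (U' l).2 (b' l m) (hb' l m) inf_le_left hW₂ (hpre l m)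
      inf_le_left hV₂ (e l) (ε₁ l m) (hε₁ l m) δl hδl
    have cm2 := restrict_restrict π halg halgA i hi (U' m).2 (b' m l) (hb'' l m) inf_le_right hW₂ (hpre l m)
      inf_le_right hV₂ (e m) (ε₂ l m) (hε₂ l m) δm hδm
    have cj3 := restrict_restrict π halg halgA i hi (U' j).2 (b' j m) (hb' j m) inf_le_left hW₃ (hpre j m)
      inf_le_left hV₃' (e j) (ε₁ j m) (hε₁ j m) δj hδj
    have cm3 := restrict_restrict π halg halgA i hi (U' m).2 (b' m j) (hb'' j m) inf_le_right hW₃ (hpre j m)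
      inf_le_right hV₃' (e m) (ε₂ j m) (hε₂ j m) δm hδm
    -- the algebra structures of the triple overlap over the three double overlaps, downstairs and upstairs
    letI aX1 : Algebra Γ(X.left, i ⁻¹ᵁ (U' j).1 ⊓ i ⁻¹ᵁ (U' l).1)
        Γ(X.left, i ⁻¹ᵁ (U' j).1 ⊓ i ⁻¹ᵁ (U' l).1 ⊓ i ⁻¹ᵁ (U' m).1) :=
      (X.left.presheaf.map (homOfLE inf_le_left).op).hom.toAlgebra
    haveI : IsScalarTower k Γ(X.left, i ⁻¹ᵁ (U' j).1 ⊓ i ⁻¹ᵁ (U' l).1)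
        Γ(X.left, i ⁻¹ᵁ (U' j).1 ⊓ i ⁻¹ᵁ (U' l).1 ⊓ i ⁻¹ᵁ (U' m).1) :=
      IsScalarTower.of_algebraMap_eq fun c => (map_algebraMap_k halg _ c).symm
    letI aX2 : Algebra Γ(X.left, i ⁻¹ᵁ (U' l).1 ⊓ i ⁻¹ᵁ (U' m).1)
        Γ(X.left, i ⁻¹ᵁ (U' j).1 ⊓ i ⁻¹ᵁ (U' l).1 ⊓ i ⁻¹ᵁ (U' m).1) :=
      (X.left.presheaf.map (homOfLE hV₂).op).hom.toAlgebra
    haveI : IsScalarTower k Γ(X.left, i ⁻¹ᵁ (U' l).1 ⊓ i ⁻¹ᵁ (U' m).1)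
        Γ(X.left, i ⁻¹ᵁ (U' j).1 ⊓ i ⁻¹ᵁ (U' l).1 ⊓ i ⁻¹ᵁ (U' m).1) :=
      IsScalarTower.of_algebraMap_eq fun c => (map_algebraMap_k halg _ c).symm
    letI aX3 : Algebra Γ(X.left, i ⁻¹ᵁ (U' j).1 ⊓ i ⁻¹ᵁ (U' m).1)
        Γ(X.left, i ⁻¹ᵁ (U' j).1 ⊓ i ⁻¹ᵁ (U' l).1 ⊓ i ⁻¹ᵁ (U' m).1) :=
      (X.left.presheaf.map (homOfLE hV₃').op).hom.toAlgebra
    haveI : IsScalarTower k Γ(X.left, i ⁻¹ᵁ (U' j).1 ⊓ i ⁻¹ᵁ (U' m).1)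
        Γ(X.left, i ⁻¹ᵁ (U' j).1 ⊓ i ⁻¹ᵁ (U' l).1 ⊓ i ⁻¹ᵁ (U' m).1) :=
      IsScalarTower.of_algebraMap_eq fun c => (map_algebraMap_k halg _ c).symm
    letI aY1 : Algebra Γ(Y.left, (U' j).1 ⊓ (U' l).1) Γ(Y.left, (U' j).1 ⊓ (U' l).1 ⊓ (U' m).1) :=
      (Y.left.presheaf.map (homOfLE inf_le_left).op).hom.toAlgebra
    haveI : IsScalarTower A Γ(Y.left, (U' j).1 ⊓ (U' l).1) Γ(Y.left, (U' j).1 ⊓ (U' l).1 ⊓ (U' m).1) :=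
      IsScalarTower.of_algebraMap_eq fun a => (map_algebraMap_A halgA _ a).symm
    letI aY2 : Algebra Γ(Y.left, (U' l).1 ⊓ (U' m).1) Γ(Y.left, (U' j).1 ⊓ (U' l).1 ⊓ (U' m).1) :=
      (Y.left.presheaf.map (homOfLE hW₂).op).hom.toAlgebra
    haveI : IsScalarTower A Γ(Y.left, (U' l).1 ⊓ (U' m).1) Γ(Y.left, (U' j).1 ⊓ (U' l).1 ⊓ (U' m).1) :=
      IsScalarTower.of_algebraMap_eq fun a => (map_algebraMap_A halgA _ a).symm
    letI aY3 : Algebra Γ(Y.left, (U' j).1 ⊓ (U' m).1) Γ(Y.left, (U' j).1 ⊓ (U' l).1 ⊓ (U' m).1) :=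
      (Y.left.presheaf.map (homOfLE hW₃).op).hom.toAlgebra
    haveI : IsScalarTower A Γ(Y.left, (U' j).1 ⊓ (U' m).1) Γ(Y.left, (U' j).1 ⊓ (U' l).1 ⊓ (U' m).1) :=
      IsScalarTower.of_algebraMap_eq fun a => (map_algebraMap_A halgA _ a).symm
    -- the triple overlap downstairs is principal in each double overlap
    have hD : ∀ j l : ι, IsAffineOpen (i ⁻¹ᵁ (U' j).1 ⊓ i ⁻¹ᵁ (U' l).1) := fun j l => by
      rw [inf_preimage_eq_basicOpen i (b' j l) (hb' j l)]
      exact (hVaff j).basicOpen _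
    have key : ∀ a b c : X.left.Opens, a ⊓ b ⊓ c = (a ⊓ b) ⊓ (a ⊓ c) := fun a b c => by
      rw [inf_assoc, inf_inf_distrib_left]
    haveI : IsLocalization.Away (X.left.presheaf.map (homOfLE (inf_le_left :
        i ⁻¹ᵁ (U' j).1 ⊓ i ⁻¹ᵁ (U' l).1 ≤ _)).op (i.app (U' j).1 (b' j m)))
        Γ(X.left, i ⁻¹ᵁ (U' j).1 ⊓ i ⁻¹ᵁ (U' l).1 ⊓ i ⁻¹ᵁ (U' m).1) :=
      (hD j l).isLocalization_of_eq_basicOpen _ (homOfLE inf_le_left) (by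
        rw [Scheme.basicOpen_res, ← inf_preimage_eq_basicOpen i (b' j m) (hb' j m), ← key])
    haveI : IsLocalization.Away (X.left.presheaf.map (homOfLE (inf_le_left :
        i ⁻¹ᵁ (U' l).1 ⊓ i ⁻¹ᵁ (U' m).1 ≤ _)).op (i.app (U' l).1 (b' l j)))
        Γ(X.left, i ⁻¹ᵁ (U' j).1 ⊓ i ⁻¹ᵁ (U' l).1 ⊓ i ⁻¹ᵁ (U' m).1) :=
      (hD l m).isLocalization_of_eq_basicOpen _ (homOfLE hV₂) (by
        rw [Scheme.basicOpen_res, ← inf_preimage_eq_basicOpen i (b' l j) (hb' l j), ← key]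
        ac_rfl)
    haveI : IsLocalization.Away (X.left.presheaf.map (homOfLE (inf_le_left :
        i ⁻¹ᵁ (U' j).1 ⊓ i ⁻¹ᵁ (U' m).1 ≤ _)).op (i.app (U' j).1 (b' j l)))
        Γ(X.left, i ⁻¹ᵁ (U' j).1 ⊓ i ⁻¹ᵁ (U' l).1 ⊓ i ⁻¹ᵁ (U' m).1) :=
      (hD j m).isLocalization_of_eq_basicOpen _ (homOfLE hV₃') (by
        rw [Scheme.basicOpen_res, ← inf_preimage_eq_basicOpen i (b' j l) (hb' j l), ← key]
        ac_rfl)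
    exact cocycle_clause_of_restrict (k := k)
      (X.left.presheaf.map (homOfLE (inf_le_left : i ⁻¹ᵁ (U' j).1 ⊓ i ⁻¹ᵁ (U' l).1 ≤ _)).op
        (i.app (U' j).1 (b' j m)))
      (X.left.presheaf.map (homOfLE (inf_le_left : i ⁻¹ᵁ (U' l).1 ⊓ i ⁻¹ᵁ (U' m).1 ≤ _)).op
        (i.app (U' l).1 (b' l j)))
      (X.left.presheaf.map (homOfLE (inf_le_left : i ⁻¹ᵁ (U' j).1 ⊓ i ⁻¹ᵁ (U' m).1 ≤ _)).op
        (i.app (U' j).1 (b' j l)))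
      (ε₁ j l) (ε₂ j l) (ε₁ l m) (ε₂ l m) (ε₁ j m) (ε₂ j m)
      δj δl δm cj1 cl1 cl2 cm2 cj3 cm3 hΦjl hΦlm hΦjm ρjl ρlm ρjm h1 h2 h3

end Literature.AlgebraicGeometry.Deformation

end
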